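import Summits.QuantumAdvantage.QuantumAdvantage.Theses.CompactnessLift
import Literature.Computability.Complexity.RelativizedTime
import Literature.Computability.Complexity.OracleBPP
import Literature.Computability.QuantumComplexity.BQTime
import Literature.Computability.Cryptography.ClassBQP

/-!
# Ideator-5 typed target (crux-ideate round 2, crux `LanguageLadder`, stmt-QuantumAdvantage-15271)

**NOT A SKELETON LINE** (no `stub_`, no `LanguageLadder_proof`; leads: do not vet it as one). NEGATIVE-SIDE typed
target for the disprover / a literature-prover, companion of `Ideator5-OracleDichotomyPositive.md` in this crux directory: the relativised honest lift /
ladder on the quantum window `n ↦ n^k`, the ORACLE DICHOTOMY target (item 15277, positive half: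
"collapse with unbounded overhead"), and the pure-logic consequence that a positive answer makes the
route's content child `UniformExponentLift` (18126) — in its relativised form — FALSE relative to
that oracle, i.e. not provable by relativising means. No oracle is constructed here (that is the
XL disprover target); this file only fixes the signatures and the bookkeeping.
-/

set_option linter.dupNamespace false

namespace Summit.QuantumAdvantage.QuantumAdvantage.Cruxes.LanguageLadder.Ideator5

open Literature.Computability.Complexity Literature.Computability.QuantumComplexity
  Literature.Computability.Cryptography

/-- Relativised honest lift at quantum exponent `k`: if every `BQTIME^A(n^k)` language is in
`BPP^A` then ONE exponent `c` puts them all in honest `BPTIME^A(n^c)`. At `k = 2` this is the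
relativised form of route item 18126 `UniformExponentLift`. [folklore] -/
def UniformExponentLiftRel (A : Language Bool) (k : ℕ) : Prop :=
  BQTimeRel A (fun n => n ^ k) ⊆ BPPRel (Oracle.ofLanguage A) →
    ∃ c : ℕ, BQTimeRel A (fun n => n ^ k) ⊆ BPTimeRel (Oracle.ofLanguage A) (fun n => n ^ c)

/-- Relativised honest ladder at quantum exponent `k` (at `k = 2`: route item 18127
`LanguageLadderR`, relativised; cf. `Census.RelativizedLadder`). [folklore] -/
def LadderRel (A : Language Bool) (k : ℕ) : Prop :=
  ∀ c : ℕ, ∃ L ∈ BQTimeRel A (fun n => n ^ k), L ∉ BPTimeRel (Oracle.ofLanguage A) (fun n => n ^ c)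

/-- **ORACLE DICHOTOMY, positive half** (item 15277, typed): an oracle relative to which
`BQP = P` (so certainly `BQP ⊆ BPP`) and yet LINEAR quantum time escapes every fixed randomised
polynomial time — "collapse with unbounded overhead". The negative note argues this is TRUE
(index-padded tabulation of gapped machines + gapped-so-far zeroing + priority spoiling +
reserved Forrelation witness regions + Beals et al. totality). [folklore] -/
def OracleDichotomyPositive : Prop :=
  ∃ A : Language Bool, BQPRel A ⊆ PRel (Oracle.ofLanguage A) ∧ LadderRel A 1

/-- The ladder is monotone in the quantum exponent (from `1` on). [folklore] -/
theorem ladderRel_mono {A : Language Bool} {k k' : ℕ} (hk : 1 ≤ k) (h : k ≤ k')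
    (hL : LadderRel A k) : LadderRel A k' := by
  intro c
  obtain ⟨L, hL, hc⟩ := hL c
  refine ⟨L, BQTimeRel_mono (fun n => ?_) hL, hc⟩
  rcases Nat.eq_zero_or_pos n with rfl | hn
  · rw [zero_pow (by omega : k ≠ 0)]; exact Nat.zero_le _
  · exact Nat.pow_le_pow_right hn h

/-- In a collapsed world the relativised lift at `k ≥ 1` is exactly the NEGATION of the ladder at `k`.
[folklore] -/
theorem liftRel_iff_not_ladderRel {A : Language Bool} {k : ℕ}
    (hcol : BQPRel A ⊆ PRel (Oracle.ofLanguage A)) :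
    UniformExponentLiftRel A k ↔ ¬ LadderRel A k := by
  have hsub : BQTimeRel A (fun n => n ^ k) ⊆ BPPRel (Oracle.ofLanguage A) :=
    ((BQTimeRel_pow_subset_BQPRel A k).trans hcol).trans (PRel_subset_BPPRel_holds _)
  constructor
  · rintro hlift hlad
    obtain ⟨c, hc⟩ := hlift hsub
    obtain ⟨L, hL, hLc⟩ := hlad c
    exact hLc (hc hL)
  · intro hlad _
    by_contra hne
    apply hlad
    intro c
    by_contra hc
    simp only [not_exists, not_and, not_not] at hc
    exact hne ⟨c, fun L hL => hc L hL⟩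

/-- **Consequence**: a positive oracle dichotomy refutes the relativised lift at EVERY quantum
exponent `k ≥ 1` relative to that oracle — in particular at `k = 2` (item 18126 relativised) and
`k = 1`. Hence no relativising proof of `UniformExponentLift` / `CompactnessPrincipleR` / CP′.
[folklore] -/
theorem exists_not_liftRel_of_positive (h : OracleDichotomyPositive) {k : ℕ} (hk : 1 ≤ k) :
    ∃ A : Language Bool, BQPRel A ⊆ PRel (Oracle.ofLanguage A) ∧ ¬ UniformExponentLiftRel A k := by
  obtain ⟨A, hcol, hlad⟩ := h
  exact ⟨A, hcol, fun hlift => (liftRel_iff_not_ladderRel hcol).1 hlift (ladderRel_mono le_rfl hk hlad)⟩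

/-- The three relativised truth-value combinations of (ladder, lift) at `k`, for the record:
`(false, true)` is automatic (a failed ladder IS a uniform exponent). [folklore] -/
theorem liftRel_of_not_ladderRel {A : Language Bool} {k : ℕ} (h : ¬ LadderRel A k) :
    UniformExponentLiftRel A k := by
  intro _
  by_contra hne
  apply h
  intro c
  by_contra hc
  simp only [not_exists, not_and, not_not] at hc
  exact hne ⟨c, fun L hL => hc L hL⟩

end Summit.QuantumAdvantage.QuantumAdvantage.Cruxes.LanguageLadder.Ideator5
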